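import Mathlib.CategoryTheory.Comma.Over.Basic
import Literature.AlgebraicGeometry.Frobenioids.AngularFrobenioidsRelative
import HarnessLib

/-!
# Frobenioids II, Theorem 3.6 (x) for `C = C^ℤ`, Step 1: a natural automorphism of `C_A → C` lies
# over the identity of `D` when `D` is slim ([FrdI] Prop. 1.13 (i) in the archimedean model)

Mochizuki, *The geometry of Frobenioids II: poly-Frobenioids*, Kyushu J. Math. **62** (2008)
401–460, §3, Theorem 3.6 (x), author's kurims text p. 38 [cite: MochizukiFrdII2008, Thm 3.6 (x) p.38]:
"(x) If `D` is slim, and `Λ ∈ {ℤ, ℝ}`, then `F` is also slim", whose printed proof (p. 38) is: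
"Assertion (x) follows formally from [FrdI], Proposition 1.13, (iii)". The first step of the proof of
[FrdI] Prop. 1.13 (pp. 39–40, assertion (i)): "Any automorphism `α` of the functor `C_A → D` determines
an automorphism of the composite `C_A →(pl-bk) D_{A_D} → D`, where `C_A → D_{A_D}` is an equivalence;
thus `α` determines an automorphism of `D_{A_D} → D`, which is necessarily trivial, since `D` is slim."
[cite: MochizukiFrdI2008, Prop. 1.13 (i) pp.39-40]

PROOF-ONLY companion (abc-iut cell, layer L1, seat abc-iut-L6-d7; PIECE 3 of abc-iut-L1-t9's
PIECES 2026-08-25T21:10:12Z / abc-iut-L1-lead (gen 2) 21:10:34Z) for abc-iut-L1-t6's Example 3.3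
`C π = C₀ ×_{D₀} D` (`AngularFrobenioidsRelative.lean`). In the model the equivalence
`C_A → D_{A_D}` is replaced by an explicit LIFT: an object `g : E → A_D` of `D_{A_D}` lifts to the object
`liftObj g = (A's angular region over π(E), E)` of `C` with the arrow `liftHom g = ((h_g, 1, 1), g) :
liftObj g → A` (`h_g` untwisted by a Galois automorphism of `π(E)`, so that it pulls `A`'s region back
to itself), arrows of `D_{A_D}` lift compatibly (`liftMap`), and every `f : B → A` factors as a
VERTICAL arrow `vert f : B → liftObj f_D` (over `id_{B_D}`) followed by `liftHom f_D`. Consequently a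
natural automorphism `α` of `C_A → C` induces one of `D_{A_D} → D` (`baseAuto`), trivial when `D` is
slim, and then every component of `α` lies over an identity of `D` (`snd_app_eq_id`). Small
constructions only (`galIso`, `liftObj`, `liftHom`, `liftMap`, `vert`, …); no new notion; nothing
printed is strengthened; nothing here bears on [IUTchIII] Cor 3.12.
-/

namespace Literature.AlgebraicGeometry.Frobenioids

open CategoryTheory Set
open scoped Pointwise

universe v u

namespace ArchFrd

namespace Slim

/-! ### `D₀`: untwisting an arrow by an automorphism of its domain -/

/-- The automorphism `gal σ` of `Spec K` (`σ = true`: complex conjugation on `Spec ℂ`; anything on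
`Spec ℝ` is the identity). [cite: MochizukiFrdII2008, Def 3.1 (i) p.23] -/
noncomputable def galIso : (K : D0) → Bool → (K ≅ K)
  | .real, _ => Iso.refl _
  | .complex, σ => ⟨D0.Hom.gal σ, D0.Hom.gal σ, by cases σ <;> rfl, by cases σ <;> rfl⟩

/-- Pre-composing an arrow `m` with `galIso (twists m)` untwists it. [cite: MochizukiFrdII2008, Def 3.1 (i) p.23] -/
theorem twists_galIso_comp {L K : D0} (m : L ⟶ K) :
    D0.Hom.twists ((galIso L (D0.Hom.twists m)).hom ≫ m) = false := by
  cases m with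
  | idReal => rfl
  | toReal => rfl
  | gal σ => cases σ <;> rfl

/-- An untwisted arrow pulls an angular region back to itself. [cite: MochizukiFrdII2008, Def 3.1 (iv) p.24] -/
theorem pullRegion_of_twists (Y : C0) {L : D0} (f : L ⟶ Y.base) (hf : D0.Hom.twists f = false) :
    C0.pullRegion Y f = Y.region.carrier := by
  unfold C0.pullRegion D0.Hom.act
  rw [hf, D0.image_galAct_false]

/-- `Hom.act (𝟙 K)` is the identity. [cite: MochizukiFrdII2008, Def 3.1 (i) p.23] -/
theorem act_id (K : D0) (c : ℂˣ) : D0.Hom.act (𝟙 K) c = c := by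
  unfold D0.Hom.act
  rw [D0.twists_id, D0.galAct_false]

section Lift

variable {D : Type u} [Category.{v} D] (π : D ⥤ D0)

/-! ### Lifting `D_{A_D}` into `C_A` ([FrdI] Prop. 1.13 (i): "`C_A →(pl-bk) D_{A_D}` is an equivalence") -/

/-- The `D₀`-arrow `π(g) ; A.iso⁻¹ : π(E) → Base(A₁)` under an object `g : E → A_D` of `D_{A_D}`.
[cite: MochizukiFrdI2008, Prop. 1.13 (i) pp.39-40] -/
noncomputable abbrev baseArrow (A : C π) (g : Over A.snd) : π.obj g.left ⟶ (PreFrobenioid.baseFunctor C0.toElem).obj A.fst := π.map g.hom ≫ A.iso.inv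

/-- An arrow of `D₀` out of `Spec ℝ` has codomain `Spec ℝ`. [cite: MochizukiFrdII2008, §3 p.23] -/
theorem eq_real_of_hom {K L : D0} (f : K ⟶ L) (hK : K = .real) : L = .real := by
  subst hK
  cases L
  · rfl
  · exact (D0.isEmpty_hom_real_complex.false f).elim

/-- The LIFT of `g : E → A_D` to an object of `C` over `E`: the angular region of `A` over `π(E)`, with
the structure isomorphism chosen so that the arrow down to `Base(A₁)` is untwisted.
[cite: MochizukiFrdI2008, Prop. 1.13 (i) pp.39-40] -/
noncomputable abbrev liftObj (A : C π) (g : Over A.snd) : C π :=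
  ⟨⟨π.obj g.left, A.fst.region, fun h =>
      A.fst.isIsotropic_of_isReal (eq_real_of_hom (baseArrow π A g) h)⟩,
    g.left, galIso (π.obj g.left) (D0.Hom.twists (baseArrow π A g))⟩

/-- The untwisted `D₀`-arrow `h_g : Base((liftObj g)₁) → Base(A₁)`. [cite: MochizukiFrdI2008, Prop. 1.13 (i) pp.39-40] -/
noncomputable abbrev liftBase (A : C π) (g : Over A.snd) : (PreFrobenioid.baseFunctor C0.toElem).obj (liftObj π A g).fst ⟶ (PreFrobenioid.baseFunctor C0.toElem).obj A.fst :=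
  (liftObj π A g).iso.hom ≫ baseArrow π A g

/-- `h_g` is untwisted. [cite: MochizukiFrdI2008, Prop. 1.13 (i) pp.39-40] -/
theorem twists_liftBase (A : C π) (g : Over A.snd) : D0.Hom.twists (liftBase π A g) = false :=
  twists_galIso_comp (baseArrow π A g)

/-- … so it pulls `A`'s region back to itself. [cite: MochizukiFrdI2008, Prop. 1.13 (i) pp.39-40] -/
theorem pullRegion_liftBase (A : C π) (g : Over A.snd) :
    C0.pullRegion A.fst (liftBase π A g) = A.fst.region.carrier :=
  pullRegion_of_twists A.fst (liftBase π A g) (twists_liftBase π A g)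

/-- The `C₀`-component `(h_g, 1, 1)` of the lifted arrow. [cite: MochizukiFrdI2008, Prop. 1.13 (i) pp.39-40] -/
noncomputable def liftHomFst (A : C π) (g : Over A.snd) : (liftObj π A g).fst ⟶ A.fst where
  base := liftBase π A g
  degFr := 1
  scalar := 1
  scalar_mem := one_mem _
  mapsTo := by
    rw [PNat.one_coe, pow_one, one_smul]
    exact (pullRegion_liftBase π A g).symm.subset

/-- The LIFTED ARROW `liftObj g → A` of `C` over `g`. [cite: MochizukiFrdI2008, Prop. 1.13 (i) pp.39-40] -/
noncomputable def liftHom (A : C π) (g : Over A.snd) : liftObj π A g ⟶ A :=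
  ⟨liftHomFst π A g, g.hom, by
    change liftBase π A g ≫ A.iso.hom = (liftObj π A g).iso.hom ≫ π.map g.hom
    simp only [Category.assoc, Iso.inv_hom_id, Category.comp_id]⟩

/-- The `D₀`-arrow between two lifts under an arrow `k : g' → g` of `D_{A_D}`.
[cite: MochizukiFrdI2008, Prop. 1.13 (i) pp.39-40] -/
noncomputable abbrev liftMapBase (A : C π) {g' g : Over A.snd} (k : g' ⟶ g) :
    (PreFrobenioid.baseFunctor C0.toElem).obj (liftObj π A g').fst ⟶ (PreFrobenioid.baseFunctor C0.toElem).obj (liftObj π A g).fst :=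
  (liftObj π A g').iso.hom ≫ π.map k.left ≫ (liftObj π A g).iso.inv

/-- `h_k ; h_g = h_{g'}`. [cite: MochizukiFrdI2008, Prop. 1.13 (i) pp.39-40] -/
theorem liftMapBase_comp (A : C π) {g' g : Over A.snd} (k : g' ⟶ g) :
    liftMapBase π A k ≫ liftBase π A g = liftBase π A g' := by
  simp only [Category.assoc, Iso.inv_hom_id_assoc]
  rw [← π.map_comp_assoc, Over.w k]

/-- The lift of `k` pulls the (common) region back to itself. [cite: MochizukiFrdI2008, Prop. 1.13 (i) pp.39-40] -/
theorem pullRegion_liftMapBase (A : C π) {g' g : Over A.snd} (k : g' ⟶ g) :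
    C0.pullRegion (liftObj π A g).fst (liftMapBase π A k) = A.fst.region.carrier := by
  have h1 : C0.pullRegion (liftObj π A g).fst (liftMapBase π A k) =
      (D0.Hom.act (liftMapBase π A k)) '' C0.pullRegion A.fst (liftBase π A g) := by
    rw [pullRegion_liftBase]
    rfl
  exact h1.trans ((C0.pullRegion_comp (liftMapBase π A k) A.fst (liftBase π A g)).symm.trans
    ((congrArg (C0.pullRegion A.fst) (liftMapBase_comp π A k)).trans (pullRegion_liftBase π A g')))

/-- The `C₀`-component `(h_k, 1, 1)` of the lift of `k`. [cite: MochizukiFrdI2008, Prop. 1.13 (i) pp.39-40] -/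
noncomputable def liftMapFst (A : C π) {g' g : Over A.snd} (k : g' ⟶ g) :
    (liftObj π A g').fst ⟶ (liftObj π A g).fst where
  base := liftMapBase π A k
  degFr := 1
  scalar := 1
  scalar_mem := one_mem _
  mapsTo := by
    rw [PNat.one_coe, pow_one, one_smul]
    exact (pullRegion_liftMapBase π A k).symm.subset

/-- The LIFT of an arrow `k : g' → g` of `D_{A_D}` to an arrow `liftObj g' → liftObj g` of `C`.
[cite: MochizukiFrdI2008, Prop. 1.13 (i) pp.39-40] -/
noncomputable def liftMap (A : C π) {g' g : Over A.snd} (k : g' ⟶ g) : liftObj π A g' ⟶ liftObj π A g :=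
  ⟨liftMapFst π A k, k.left, by
    change liftMapBase π A k ≫ (liftObj π A g).iso.hom = (liftObj π A g').iso.hom ≫ π.map k.left
    simp only [Category.assoc, Iso.inv_hom_id, Category.comp_id]⟩

/-- The lift of `k` is an arrow over `A`: `liftMap k ; liftHom g = liftHom g'`.
[cite: MochizukiFrdI2008, Prop. 1.13 (i) pp.39-40] -/
theorem liftMap_comp_liftHom (A : C π) {g' g : Over A.snd} (k : g' ⟶ g) :
    liftMap π A k ≫ liftHom π A g = liftHom π A g' := by
  refine CFP.hom_ext (C0.hom_ext ?_ ?_ ?_) ?_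
  · exact liftMapBase_comp π A k
  · rfl
  · rw [CFP.comp_fst, C0.scalar_comp']
    change (D0.Hom.act (liftMapBase π A k)) 1 * 1 ^ ((1 : ℕ+) : ℕ) = 1
    rw [map_one, one_pow, mul_one]
  · exact Over.w k

/-- The lift of `k` as an arrow of `C_A`. [cite: MochizukiFrdI2008, Prop. 1.13 (i) pp.39-40] -/
noncomputable def liftOver (A : C π) {g' g : Over A.snd} (k : g' ⟶ g) :
    Over.mk (liftHom π A g') ⟶ Over.mk (liftHom π A g) :=
  Over.homMk (liftMap π A k) (liftMap_comp_liftHom π A k)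

/-! ### Step 1: a natural automorphism of `C_A → C` lies over the identity of `D` -/

/-- The natural automorphism of `D_{A_D} → D` induced by a natural automorphism `α` of `C_A → C`
through the lifts. [cite: MochizukiFrdI2008, Prop. 1.13 (i) pp.39-40] -/
noncomputable def baseAuto (A : C π) (α : Over.forget A ≅ Over.forget A) :
    Over.forget A.snd ≅ Over.forget A.snd :=
  NatIso.ofComponents (fun g => (CFP.proj₂ _ _).mapIso (α.app (Over.mk (liftHom π A g)))) (by
    intro g' g k
    exact congrArg CFP.Hom.snd (α.hom.naturality (liftOver π A k)))

/-- `D` slim ⇒ the lifted components of `α` have trivial `D`-part. [cite: MochizukiFrdI2008, Prop. 1.13 (i) pp.39-40] -/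
theorem snd_app_liftHom (hD : IsSlim D) (A : C π) (α : Over.forget A ≅ Over.forget A)
    (g : Over A.snd) : (α.app (Over.mk (liftHom π A g))).hom.snd = 𝟙 g.left :=
  congrArg (fun γ : Over.forget A.snd ≅ Over.forget A.snd => γ.hom.app g)
    (hD.isRigid_forget A.snd (baseAuto π A α))

/-- `Base(f₁) = (B.iso ; (lift iso)⁻¹) ; h_{f_D}` for `f : B → A`. [cite: MochizukiFrdI2008, Prop. 1.13 (i) pp.39-40] -/
theorem base_fst_eq (A : C π) (f : Over A) :
    (PreFrobenioid.baseFunctor C0.toElem).map f.hom.fst =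
      (f.left.iso.hom ≫ (liftObj π A (Over.mk f.hom.snd)).iso.inv) ≫ liftBase π A (Over.mk f.hom.snd) := by
  rw [(Iso.eq_comp_inv A.iso).mpr f.hom.w]
  have step1 := Category.assoc f.left.iso.hom (π.map f.hom.snd) A.iso.inv
  have step3 := Category.assoc f.left.iso.hom (liftObj π A (Over.mk f.hom.snd)).iso.inv
    ((liftObj π A (Over.mk f.hom.snd)).iso.hom ≫ baseArrow π A (Over.mk f.hom.snd))
  have step4 := congrArg (f.left.iso.hom ≫ ·)
    ((liftObj π A (Over.mk f.hom.snd)).iso.inv_hom_id_assoc (baseArrow π A (Over.mk f.hom.snd)))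
  exact step1.trans (step3.trans step4).symm

/-- The VERTICAL arrow `B → liftObj (f_D)` through which `f : B → A` factors (same degree and scalar as
`f`, base `B.iso ; (lift iso)⁻¹`). [cite: MochizukiFrdI2008, Prop. 1.13 (i) pp.39-40] -/
noncomputable def vertFst (A : C π) (f : Over A) :
    f.left.fst ⟶ (liftObj π A (Over.mk f.hom.snd)).fst where
  base := f.left.iso.hom ≫ (liftObj π A (Over.mk f.hom.snd)).iso.inv
  degFr := C0.degFr f.hom.fst
  scalar := C0.scalar f.hom.fst
  scalar_mem := f.hom.fst.scalar_mem
  mapsTo := by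
    have h := f.hom.fst.mapsTo
    have hp : C0.pullRegion A.fst (C0.Base f.hom.fst) =
        C0.pullRegion (liftObj π A (Over.mk f.hom.snd)).fst
          (f.left.iso.hom ≫ (liftObj π A (Over.mk f.hom.snd)).iso.inv) := by
      have h1 : C0.pullRegion A.fst (C0.Base f.hom.fst) = C0.pullRegion A.fst
          ((f.left.iso.hom ≫ (liftObj π A (Over.mk f.hom.snd)).iso.inv) ≫
            liftBase π A (Over.mk f.hom.snd)) := congrArg (C0.pullRegion A.fst) (base_fst_eq π A f)
      rw [h1, C0.pullRegion_comp, pullRegion_liftBase]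
      rfl
    exact h.trans hp.subset

/-- The vertical arrow `B → liftObj (f_D)` of `C` (over the identity of `B_D`).
[cite: MochizukiFrdI2008, Prop. 1.13 (i) pp.39-40] -/
noncomputable def vert (A : C π) (f : Over A) : f.left ⟶ liftObj π A (Over.mk f.hom.snd) :=
  ⟨vertFst π A f, 𝟙 f.left.snd, by
    change (f.left.iso.hom ≫ (liftObj π A (Over.mk f.hom.snd)).iso.inv) ≫
        (liftObj π A (Over.mk f.hom.snd)).iso.hom = f.left.iso.hom ≫ π.map (𝟙 _)
    rw [CategoryTheory.Functor.map_id, Category.comp_id]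
    exact (Category.assoc _ _ _).trans
      ((congrArg (f.left.iso.hom ≫ ·) (liftObj π A (Over.mk f.hom.snd)).iso.inv_hom_id).trans
        (Category.comp_id _))⟩

/-- `vert f ; liftHom f_D = f`. [cite: MochizukiFrdI2008, Prop. 1.13 (i) pp.39-40] -/
theorem vert_comp_liftHom (A : C π) (f : Over A) :
    vert π A f ≫ liftHom π A (Over.mk f.hom.snd) = f.hom := by
  refine CFP.hom_ext (C0.hom_ext ?_ ?_ ?_) ?_
  · exact (base_fst_eq π A f).symm
  · exact mul_one _
  · rw [CFP.comp_fst, C0.scalar_comp']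
    change (D0.Hom.act (f.left.iso.hom ≫ (liftObj π A (Over.mk f.hom.snd)).iso.inv)) 1 *
      C0.scalar f.hom.fst ^ ((1 : ℕ+) : ℕ) = C0.scalar f.hom.fst
    rw [map_one, one_mul, PNat.one_coe, pow_one]
  · exact Category.id_comp _

/-- **Step 1** ([FrdI] Prop. 1.13 (i) for `C`): for `D` slim, every component of a natural
automorphism of `C_A → C` lies over the identity of `D`. [cite: MochizukiFrdI2008, Prop. 1.13 (i) pp.39-40] -/
theorem snd_app_eq_id (hD : IsSlim D) (A : C π) (α : Over.forget A ≅ Over.forget A) (f : Over A) :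
    (α.app f).hom.snd = 𝟙 f.left.snd := by
  have hnat := α.hom.naturality (Over.homMk (vert π A f) (vert_comp_liftHom π A f) :
    f ⟶ Over.mk (liftHom π A (Over.mk f.hom.snd)))
  have h2 : (vert π A f).snd ≫ (α.app (Over.mk (liftHom π A (Over.mk f.hom.snd)))).hom.snd =
      (α.app f).hom.snd ≫ (vert π A f).snd := congrArg CFP.Hom.snd hnat
  have h1 := snd_app_liftHom π hD A α (Over.mk f.hom.snd)
  have e1 : (α.app f).hom.snd = (α.app f).hom.snd ≫ (vert π A f).snd := (Category.comp_id _).symm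
  have e2 : (vert π A f).snd ≫ (α.app (Over.mk (liftHom π A (Over.mk f.hom.snd)))).hom.snd =
      𝟙 f.left.snd := by
    rw [h1]
    exact Category.comp_id _
  exact e1.trans (h2.symm.trans e2)

end Lift

end Slim

end ArchFrd

end Literature.AlgebraicGeometry.Frobenioids
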